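import Summits.Ventures.CertifiedManyBodySolver.Theorems.M3x2EdgeSplitSymReplayGramRShardsFast
import Summits.Ventures.CertifiedManyBodySolver.Theorems.M3x2EdgeSplitSymReplayLocalB
import HarnessLib

/-!
# SymReplay gramR — the LOCAL base shard under the R-blocks: sharded local R-replay is sound (R × T16; module 2/2 of `GramRShardsFast`)
(pen hub-lb-sym-plan-1 g2, 2026-08-28, rev 2 = crux workfile `Cruxes/LowerEdge_ge_m83o100/GramRShardsFast_symplan1.lean`
8a70004e41b9, sha16 b4aa7cc53e8357bb, §(f)–(g) byte-identical except that the end-to-end toy theorem is an `example`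
(its statement coincides with `…GramRSoundB`'s toy bound); landed by the one writer hub-lb-sym-eng-3.  ADDITIVE on
`…GramRShardsFast` (§(a)–(e)) and `…LocalA/…LocalB` (T16); nothing of them is touched.)

§(f) THE PATH OF RECORD — LOCAL base (T16 `rhsPolyL`, zero-filtered pipe `canonNFZV`) under the R-blocks: `shardPolysRL K c :=
shardPolysL K.toSymCert c ++ R-chunks`, `sum_shardPolysRL` (= the R-shards' operator sum, via `sum_shardPolysL`), `shardPolyAtRLFast`
(+ `_eq`), `shardCountR_eq_lengthRL`, `shardOKRLV` / `ShardFactsRLV` / `facts₂Z_of_shardFactsRLV` (T16b's `Facts₂Z`, `facts₂Z_sum`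
reused by name), **`wardD4CertGe_of_shardsRLV`** (the `…GramRShards` assembly with `canonNFZUses` and the local base) and
`energyDensity_ge_of_shardsRLV`; §(g) `toyRCert` END TO END through the local sharded R-pipe (kernel only).

MULTI-CALL CLOSING GRAMMAR (path of record for an R-literal `K := decodeSymCertR (toks certS) (toks gramRS)` on v0′/E₁):
per shard `j < shardCountR K c` one theorem `shard_j : shardOKRLV K c j P_j = true := by native_decide`; per R-block
`rok_i : gramROKAt K i = true := by native_decide`; then `hwf : wellFormed K.expand = true`, `hcount : shardCountR K c = m + 1`,
`hRok := gramR_all_of_facts K n (by native_decide) ⟨rok_0, …, trivial⟩`, `hfacts : ShardFactsRLV K c 0 [P₀, …, P_m] :=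
⟨shard_0, …, shard_m, trivial⟩`, `hfin : isZero (canonNFZV K.frame [P₀, …].flatten) = true`, and
`energyDensity_ge_of_shardsRLV K hwf hRok c [P₀,…] hcount hfacts hfin` (or `nearCertWardSlack_of_wardD4CertGe
(wardD4CertGe_of_shardsRLV …) (by norm_num)` for the registered `≥ −83/100` stub).

HONEST FRAMING: plumbing for a checker COST lever with its soundness theorem; no certificate beyond the toy is replayed; no bound
of record moves; no summit or crux statement is proved here; nothing here predicts superconductivity.
-/

noncomputable section

namespace Summit.Ventures.CertifiedManyBodySolver.Theorems.SymReplay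

open Matrix Finset
open Literature.MathematicalPhysics.QuantumLattice
open Literature.MathematicalPhysics.QuantumLattice.HubbardWave0
open Literature.MathematicalPhysics.QuantumLattice.ThermodynamicLimit
open Literature.Probability.LatticeModels
open Literature.MathematicalPhysics.QuantumManyBody.StateRelaxation
open Summit.Ventures.CertifiedManyBodySolver.Theorems.WardSlot
open scoped ComplexOrder BigOperators

/-! ##### (f) LOCAL base shard (T16 `rhsPolyL`, zero-filtered pipe `canonNFZV`) under the R-blocks — the path of record -/

/-- The well-formedness of the expansion `K♯` contains that of the base certificate. -/
theorem wellFormed_toSymCert_of_expand (K : SymCertR) (h : wellFormed K.expand = true) :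
    wellFormed K.toSymCert = true := by
  have h' := h
  simp only [wellFormed, SymCertR.expand, Bool.and_eq_true] at h' ⊢
  obtain ⟨⟨⟨⟨⟨⟨⟨⟨⟨⟨⟨⟨⟨hnd, hz0⟩, hn0⟩, hIF⟩, hth⟩, hgram⟩, hgM⟩, heom⟩, hmov⟩, hch⟩, hwp⟩, hwm⟩, hah⟩, hsl⟩ := h'
  refine ⟨⟨⟨⟨⟨⟨⟨⟨⟨⟨⟨⟨⟨hnd, hz0⟩, hn0⟩, hIF⟩, hth⟩, hgram⟩, ?_⟩, heom⟩, hmov⟩, hch⟩, hwp⟩, hwm⟩, hah⟩, hsl⟩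
  rw [List.all_eq_true] at hgM ⊢
  exact fun B hB => hgM B (List.mem_append_left _ hB)

/-- **LOCAL R-shard list**: T16b's local shards of the base certificate (local base shard, `gramM` row chunks), then the
R-block representative chunks. -/
def shardPolysRL (K : SymCertR) (c : ℕ) : List QPoly :=
  shardPolysL K.toSymCert c ++ K.gramR.flatMap (blockShardPolysR c)

/-- The local R-shards have the same operator sum as the R-shards (in any window containing the frame). -/
theorem sum_shardPolysRL {Λ' : Finset (Site 2)} (K : SymCertR) (hwf : wellFormed K.toSymCert = true)
    (hFL : K.frame.toFinset ⊆ Λ') (c : ℕ) :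
    ((shardPolysRL K c).map (polyOp Λ')).sum = ((shardPolysR K c).map (polyOp Λ')).sum := by
  rw [shardPolysRL, shardPolysR, List.map_append, List.sum_append, List.map_append, List.sum_append,
    sum_shardPolysL K.toSymCert hwf hFL c, sum_shardPolys]

/-- **Local R-shard `j`, computed alone**: T16b's `shardPolyAtLFast` on the base certificate, then the R-block walk. -/
def shardPolyAtRLFast (K : SymCertR) (c j : ℕ) : QPoly :=
  if j < shardCount K.toSymCert c then shardPolyAtLFast K.toSymCert c j
  else shardsFromR c K.gramR (j - shardCount K.toSymCert c)

/-- The fast local accessor agrees with indexing `shardPolysRL`. -/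
theorem shardPolyAtRLFast_eq (K : SymCertR) (c j : ℕ) :
    shardPolyAtRLFast K c j = ((shardPolysRL K c)[j]?).getD [] := by
  unfold shardPolyAtRLFast shardPolysRL
  split_ifs with h
  · rw [shardPolyAtLFast_eq, List.getElem?_append_left (by rwa [← shardCount_eq_lengthL])]
  · rw [List.getElem?_append_right (by rw [← shardCount_eq_lengthL]; omega), ← shardCount_eq_lengthL, shardsFromR_eq]

/-- `shardCountR` also counts the local R-shards. -/
theorem shardCountR_eq_lengthRL (K : SymCertR) (c : ℕ) : shardCountR K c = (shardPolysRL K c).length := by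
  rw [shardCountR, shardPolysRL, List.length_append, shardCount_eq_lengthL, List.length_flatMap]
  congr 2
  exact List.map_congr_left fun B _ => (length_blockShardPolysR c B).symm

/-- **What ONE farm call proves about local R-shard `j`** (zero-filtered executed pipe of T16b). -/
def shardOKRLV (K : SymCertR) (c j : ℕ) (P : QPoly) : Bool :=
  psuppIn P K.frame && isZero (psub (canonNFZV K.frame (shardPolyAtRLFast K c j)) P)

/-- The per-call facts, local executed form (structural on the literal partial list). -/
def ShardFactsRLV (K : SymCertR) (c : ℕ) : ℕ → List QPoly → Prop
  | _, [] => True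
  | j, P :: Ps => shardOKRLV K c j P = true ∧ ShardFactsRLV K c (j + 1) Ps

/-- Index-based local R-facts give T16b's two-list facts `Facts₂Z` on the corresponding suffix of `shardPolysRL`. -/
theorem facts₂Z_of_shardFactsRLV (K : SymCertR) (c : ℕ) :
    ∀ (Ps : List QPoly) (j : ℕ), ((shardPolysRL K c).drop j).length = Ps.length →
      ShardFactsRLV K c j Ps → Facts₂Z K.toSymCert ((shardPolysRL K c).drop j) Ps
  | [], j, hl, _ => by
    rw [List.length_nil, List.length_eq_zero_iff] at hl
    rw [hl]; trivial
  | P :: Ps, j, hl, hf => by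
    have hj : j < (shardPolysRL K c).length := by
      rw [List.length_drop, List.length_cons] at hl; omega
    rw [List.drop_eq_getElem_cons hj]
    have hQ : shardPolyAtRLFast K c j = (shardPolysRL K c)[j] := by
      rw [shardPolyAtRLFast_eq, List.getElem?_eq_getElem hj]; rfl
    refine ⟨?_, facts₂Z_of_shardFactsRLV K c Ps (j + 1) ?_ hf.2⟩
    · rw [← hQ]; exact hf.1
    · have := hl; rw [List.drop_eq_getElem_cons hj, List.length_cons, List.length_cons] at this; omega

/-- **SHARDED LOCAL R-REPLAY IS SOUND**: T16b's sharded local replay (`rhsPolyL` base, zero filter) with the R-blocks'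
representative chunks appended; the R-blocks' side conditions `hRok` as in `…GramRShards` (or assembled per block by
`gramR_all_of_facts`). -/
theorem wardD4CertGe_of_shardsRLV (K : SymCertR) (hwf0 : wellFormed K.expand = true)
    (hRok : K.gramR.all (gramBlockROK K.frame) = true) (c : ℕ) (Ps : List QPoly)
    (hcount : shardCountR K c = Ps.length) (hfacts : ShardFactsRLV K c 0 Ps)
    (hfin : isZero (canonNFZV K.frame Ps.flatten) = true) : WardD4CertGe ((symValueR K : ℚ) : ℝ) := by
  have hRok' : ∀ B ∈ K.gramR, gramBlockROK K.frame B = true := List.all_eq_true.1 hRok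
  have hwfb : wellFormed K.toSymCert = true := wellFormed_toSymCert_of_expand K hwf0
  /- (1) supports -/
  have hgM' : ∀ B ∈ K.toSymCert.gramM, ∀ q ∈ B.basis, PSupp q K.frame.toFinset := fun B hB q hq => by
    have hwf' := hwfb
    simp only [wellFormed, Bool.and_eq_true] at hwf'
    obtain ⟨⟨⟨⟨⟨⟨⟨⟨⟨⟨⟨⟨⟨-, -⟩, -⟩, -⟩, -⟩, -⟩, hgM⟩, -⟩, -⟩, -⟩, -⟩, -⟩, -⟩, -⟩ := hwf'
    have h := List.all_eq_true.1 hgM B hB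
    simp only [gramBlockOK, Bool.and_eq_true, List.all_eq_true] at h
    exact PSupp_of_psuppIn (h.2 q hq)
  have hsD : ∀ B ∈ K.gramR, (∀ s ∈ B.reps, PSupp s K.frame.toFinset) ∧ ∀ q ∈ genBasis B, PSupp q K.frame.toFinset :=
    fun B hB => ⟨fun s hs => ((gramBlockROK_spec (hRok' B hB)).1 s hs).1, fun q hq => by
      rw [genBasis, List.mem_map] at hq
      obtain ⟨s, hs, rfl⟩ := hq
      exact PSupp_genOne ((gramBlockROK_spec (hRok' B hB)).1 s hs).2⟩
  have hQ : ∀ Q ∈ shardPolysRL K c, PSupp Q K.frame.toFinset := by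
    intro Q hQ
    rw [shardPolysRL, List.mem_append, shardPolysL, List.mem_cons] at hQ
    rcases hQ with (rfl | hQ) | hQ
    · exact (PSupp_lhsPoly K.toSymCert (thicken_zero_subset_of_wellFormed K.toSymCert hwfb)).psub
        (PSupp_rhsNonBlockL K.toSymCert hwfb)
    · rw [List.mem_flatMap] at hQ
      obtain ⟨B, hB, hQ⟩ := hQ
      exact PSupp_blockShardPolys c B (hgM' B hB) Q hQ
    · rw [List.mem_flatMap] at hQ
      obtain ⟨B, hB, hQ⟩ := hQ
      exact PSupp_blockShardPolysR c B (hsD B hB).1 (hsD B hB).2 Q hQ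
  /- (2) the two-list facts -/
  have hlen : (shardPolysRL K c).length = Ps.length := (shardCountR_eq_lengthRL K c).symm.trans hcount
  have hF : Facts₂Z K.toSymCert (shardPolysRL K c) Ps := by
    have h := facts₂Z_of_shardFactsRLV K c Ps 0 (by rw [List.drop_zero]; exact hlen) hfacts
    rwa [List.drop_zero] at h
  /- (3) the DERIVED use family and its envelope -/
  let U := ((shardPolysRL K c).flatMap (canonNFZUses K.frame) ++ canonNFZUses K.frame Ps.flatten) ++
    (K.gramR.flatMap blockUses).map negUse
  have hL : (envelope K.expand U).toList.toFinset = envelope K.expand U := Finset.toList_toFinset _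
  have hFL : K.frame.toFinset ⊆ (envelope K.expand U).toList.toFinset := by
    rw [hL]; exact (subset_thicken _ 1).trans (thicken_subset_envelope K.expand U)
  obtain ⟨hsum, hPs⟩ := facts₂Z_sum K.toSymCert hFL (shardPolysRL K c) Ps hF hQ
  have hU : ∀ e ∈ U, SuppIn e.u K.expand.frame.toFinset := by
    intro e he
    rcases List.mem_append.1 he with he | he
    · rcases List.mem_append.1 he with he | he
      · rw [List.mem_flatMap] at he
        obtain ⟨Q, hQ', he⟩ := he
        exact canonNFZUses_supp K.frame Q (hQ Q hQ') e he
      · exact canonNFZUses_supp K.frame _ hPs e he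
    · rw [List.mem_map] at he
      obtain ⟨e', he', rfl⟩ := he
      rw [List.mem_flatMap] at he'
      obtain ⟨B, hB, he'⟩ := he'
      rw [blockUses, List.mem_flatMap] at he'
      obtain ⟨m, -, he'⟩ := he'
      obtain ⟨t, ht, hu⟩ := polyUses_u he'
      show SuppIn e'.u K.frame.toFinset
      rw [hu]
      exact PSupp_gramBlockPolyR B (hsD B hB).1 (hsD B hB).2 t ht
  refine wardD4CertGe_of_expansion K.expand hwf0 U hU ?_
  /- (4) the expansion -/
  have hBL : ∀ B ∈ K.gramR, (∀ s ∈ B.reps, PSupp (genPre B.moves s) (envelope K.expand U).toList.toFinset) ∧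
      ∀ q ∈ genBasis B, ∀ m ∈ B.moves,
        PSupp (movePolyF m.γ m.v q) (envelope K.expand U).toList.toFinset ∧
          isZero (psub (nfPoly (movePolyF m.γ m.v q)) (pscale m.χ q)) = true := fun B hB =>
    ⟨fun s hs => (((gramBlockROK_spec (hRok' B hB)).1 s hs).2).mono hFL,
      fun q hq m hm => ⟨((gramBlockROK_spec (hRok' B hB)).2 q hq m hm).1.mono hFL,
        ((gramBlockROK_spec (hRok' B hB)).2 q hq m hm).2⟩⟩
  have h2 := polyOp_rhsPoly_expand (envelope K.expand U).toList.toFinset K hBL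
  have hfinal := canonNFZV_expansion K.frame hFL Ps.flatten (hPs.mono hFL)
  rw [polyOp_eq_zero_of_isZero _ _ hfin, zero_add] at hfinal
  rw [sum_shardPolysRL K hwfb hFL, sum_shardPolysR] at hsum
  have hl : lhsPoly K.expand = lhsPoly K.toSymCert := rfl
  have hneg : (((K.gramR.flatMap blockUses).map negUse).map (useOp (envelope K.expand U).toList.toFinset)).sum =
      -((K.gramR.flatMap blockUses).map (useOp (envelope K.expand U).toList.toFinset)).sum := by
    rw [List.map_map, ← list_sum_map_neg]
    simp only [Function.comp_def, useOp_negUse]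
  rw [hl, h2, List.map_append, List.sum_append, List.map_append, List.sum_append, ← hfinal, hneg,
    sub_eq_iff_eq_add.1 hsum]
  abel

/-- **Sharded LOCAL R-replay, closing theorem**: `symValueR K ≤ e₀(1,0,8,7/8)`.  CLOSING GRAMMAR (path of record for an
R-literal on v0′/E₁): per shard `j < shardCountR K c` one theorem `shard_j : shardOKRLV K c j P_j = true := by
native_decide`; per R-block `rok_i : gramROKAt K i = true := by native_decide`; then `hwf : wellFormed K.expand = true`,
`hcount : shardCountR K c = m + 1`, `hRok := gramR_all_of_facts K n (by native_decide) ⟨rok_0, …, trivial⟩`,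
`hfacts : ShardFactsRLV K c 0 [P₀, …, P_m] := ⟨shard_0, …, shard_m, trivial⟩`,
`hfin : isZero (canonNFZV K.frame [P₀, …].flatten) = true`. -/
theorem energyDensity_ge_of_shardsRLV (K : SymCertR) (hwf : wellFormed K.expand = true)
    (hRok : K.gramR.all (gramBlockROK K.frame) = true) (c : ℕ) (Ps : List QPoly)
    (hcount : shardCountR K c = Ps.length) (hfacts : ShardFactsRLV K c 0 Ps)
    (hfin : isZero (canonNFZV K.frame Ps.flatten) = true) :
    ((symValueR K : ℚ) : ℝ) ≤ energyDensityTT' 1 0 8 (7 / 8) :=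
  energyDensity_ge_of_windowSound_cert _ WardSlot.stub_wardWindowSound
    (wardD4CertGe_of_shardsRLV K hwf hRok c Ps hcount hfacts hfin)

/-! ##### (g) Kernel demo: `toyRCert` through the LOCAL sharded R-pipe end to end -/

/-- The toy's local R-shard partials (zero-filtered canonical forms of the three local R-shards). -/
def toyRLPartials : List QPoly :=
  [canonNFZV toyRCert.frame (shardPolyAtRLFast toyRCert 0 0), canonNFZV toyRCert.frame (shardPolyAtRLFast toyRCert 0 1),
    canonNFZV toyRCert.frame (shardPolyAtRLFast toyRCert 0 2)]

/-- End to end on the toy: `−11/4 = symValueR toyRCert ≤ e₀(1,0,8,7/8)` through `energyDensity_ge_of_shardsRLV`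
(every hypothesis by `decide +kernel`; standard axioms; an `example` — the statement is `…GramRSoundB`'s toy bound). -/
example : ((symValueR toyRCert : ℚ) : ℝ) ≤ energyDensityTT' 1 0 8 (7 / 8) :=
  energyDensity_ge_of_shardsRLV toyRCert (by decide +kernel)
    (gramR_all_of_facts toyRCert 2 (by decide +kernel) ⟨by decide +kernel, by decide +kernel, trivial⟩) 0 toyRLPartials
    (by decide +kernel) ⟨by decide +kernel, by decide +kernel, by decide +kernel, trivial⟩ (by decide +kernel)

/-- Non-vacuity: no single local R-shard of the toy closes against the empty partial. -/
example : shardOKRLV toyRCert 0 0 [] = false ∧ shardOKRLV toyRCert 0 2 [] = false := by decide +kernel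

end Summit.Ventures.CertifiedManyBodySolver.Theorems.SymReplay
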